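import Summits.QuantumFields.BalabanUV.Beta.GAN24.CombSlotResumTransport
import Summits.QuantumFields.BalabanUV.Beta.GAN24.SlotTransportParity
import Summits.QuantumFields.BalabanUV.Beta.GAN24.LayerCommutatorAntisymm
import Summits.QuantumFields.BalabanUV.Beta.BubbleParity

/-!
# `BalabanUV.Beta.GAN24.TransportedWordTools` — binder row G-an2-4 ∕ (CONV-C), TRANSFER-III, the (III′) (C)-campaign's supplier `hB0`, (24) AT THE COMB DATA (leaf-01 g85
# `README-g85` «LOCATED» (24)_comb), THE KERNEL-ALGEBRA HALF: **THE CONJUGATED TWO-FACE WORD `((Ψ̂ᵀP′Ψ̂) ∘ X) ∘ (Ψ̂ᵀV′Ψ̂)` RE-ASSOCIATES TO `Ψ̂ᵀ ∘ ((P′ ∘ Ψ̂XΨ̂ᵀ) ∘ V′) ∘ Ψ̂` AND LOSES ITS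
# OUTER LEGS UNDER PERIODIC BOUNDED LEG WEIGHTS; leg antisymmetry and entrywise vanishing pass `slotPsiS` and the units; `sgnK` and `trK` of the sandwich `Ψ̂XΨ̂ᵀ`; the `hkill`-transfer**
# (G-an2-4 CRUX TEAM (2), leaf prover `b2b-balaban-gan24-formalise-leaf-01`, gen 86; journal [LEAF01-G86-INTENT-1]; consumer: `TransportedWordReduction`)

NOT IN PRINT; OUR BOOKKEEPING ([folklore] tame-kernel bookkeeping BY NAME over leaf-01 g85 `CombSlotResumTransport` (§3b `tsum_sum_conj_psiKS_inr_inl_mul_periodic`, §3c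
`tsum_prod_weight_conj_psiKS`), an5's `TameKernelCalculus` (`comp_assoc_tame`, `Spr ∕ Loc`), an2's `BalabanStepJetsSucc.decays_comp ∕ biLoc_comp_right`, `ExpKernelCalculus.biLoc_comp_biLoc`,
leaf-02's `BubbleParity` (`vertexOfK_apply_eq_zero`, `trK_vertexOfK_of_antisymm`) ∕ `SlotTransportParity.slotPsiS_neg` ∕ `LayerCommutatorAntisymm.trK_unitK_coDress`, an2's `BorderedHessian.sgnK`,
d1-leaf-03's `SymCorrectorKernel` (`psiKS`, its vanishing mixed blocks) ∕ `SymCorrectorFace.slotPsiS_apply_kernel`, leaf-01 g85 `CombTransportedBorder.slotPsiS_entry_eq_zero`; 0 `def`, 0 cited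
fact, 0 `def … : Prop`, 0 sorry).
HONEST FRAMING (cell contract, verbatim): «discharging `BetaPertH` makes Bałaban's UV stability UNCONDITIONAL — a real constructive-QFT result; it is NOT the continuum limit and NOT
the Clay problem.»  HONEST DEPENDENCY (verbatim): «continuum YM on T⁴ ⇐ BetaPertH ∧ nine spine estimates (0/9 proved); BetaPertH ⇐ (D1) ∧ (D4) ∧ CAP+tail; G-an2-4 gates asym, D1
and NE2/3/4.»

## What is proved (generic `d`; `Ψ̂ = psiKS r n`, `0 < n`, `r ∈ box (d+1) n`)
* §1 `exists_decays_sandwich ∕ spr_sandwich ∕ spr_psiKS_comp` (`Ψ̂XΨ̂ᵀ`, `Ψ̂X` decay), **`conj_word_assoc`** (`((Ψ̂ᵀP′Ψ̂) ∘ X) ∘ (Ψ̂ᵀV′Ψ̂) = Ψ̂ᵀ ∘ ((P′ ∘ (Ψ̂XΨ̂ᵀ)) ∘ V′) ∘ Ψ̂` for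
  localised `P′ V′`, spread `X`), `exists_biLoc_inner_word`, **`tsum_twoFace_conj_word_eq`** (under `n`-periodic bounded leg weights the OUTER legs drop:
  `Σ'_{(y,w)} ω₁ω₂·(((Ψ̂ᵀP′Ψ̂) ∘ X) ∘ (Ψ̂ᵀV′Ψ̂)) y w a b = Σ'_{(y,w)} ω₁ω₂·((P′ ∘ Ψ̂XΨ̂ᵀ) ∘ V′) y w a b` — F8 §3c).
* §2 `slotPsiS_antisymm`, `unitS_antisymm`, **`trK_vertexOfK_unitS_slotPsiS`** (leg antisymmetry of `T` ⇒ `trK V = −V` for the vertex over `unitS (slotPsiS T)`),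
  **`vertexOfK_unitS_slotPsiS_entry_eq_zero`** (an entrywise vanishing of every member of `T` passes to that vertex: no ff block ∕ no multiplier first legs).
* §3 `psiKS_sgnF ∕ sgnF_trK_psiKS`, **`sgnK_sandwich`** (`sgnK (Ψ̂XΨ̂ᵀ) = Ψ̂ (sgnK X) Ψ̂ᵀ`), **`trK_sandwich`** (`trK (Ψ̂XΨ̂ᵀ) = Ψ̂ (trK X) Ψ̂ᵀ`), **`trK_sandwich_dressedStep`**
  (`trK (Ψ̂X̃♮_jΨ̂ᵀ) = sgnK (Ψ̂X̃♮_jΨ̂ᵀ)`, every `j`, in-block kernel root).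
* §4 **`tsum_sum_sandwich_inr_inl_mul_eq_zero`**: if the multiplier rows of a decaying `X` kill an `n`-periodic bounded current, so do those of `Ψ̂XΨ̂ᵀ` (F8 §3b).
WHAT THIS IS NOT: no word is killed here; NO value; NOT `hB0`; NEVER «G-an2-4 closed» as (CONV-C); NOT D1, NOT `BetaPertH`, NOT continuum, NOT Clay.  2026-08-27; no existing file touched.
-/

noncomputable section

open Finset
open scoped BigOperators
open Literature.MathematicalPhysics.QuantumFieldTheory
open Literature.MathematicalPhysics.QuantumFieldTheory.Balaban1983to89
open Literature.MathematicalPhysics.QuantumFieldTheory.Balaban1983to89.Beta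
open ExpKernelCalculus (Site MKer comp Decays BiLoc biLoc_comp_biLoc)
open BalabanStepJetsSucc (biLoc_comp_right decays_comp)
open AffineAveraging (box toSite)
open OneStepResolventKernel (Fib)
open OneStepKernelFamily (KInvStep vertexOfK decays_KInvStep)
open Summit.QuantumFields.BalabanUV.Beta.TameKernelCalculus (trK trK_apply trK_comp trK_trK Spr Loc Tame comp_assoc_tame decays_trK decays_of_le biLoc_of_le)
open Summit.QuantumFields.BalabanUV.Beta.BorderedHessian (sgnK sgnK_apply sgnF sgnF_inl sgnF_inr)
open Summit.QuantumFields.BalabanUV.Beta.AxialDressingRooted (coDressKBmAt decays_coDressKBmAt)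
open Summit.QuantumFields.BalabanUV.Beta.HessKerDressedUnits (unitK unitS unitS_apply decays_unitK)
open Summit.QuantumFields.BalabanUV.Beta.SymCorrectorKernel (psiKS spr_psiKS decays_psiKS psiKS_inl_inr psiKS_inr_inl)
open Summit.QuantumFields.BalabanUV.Beta.SymCorrectorFace (slotPsiS slotPsiS_apply_kernel)
open Summit.QuantumFields.BalabanUV.Beta.GAN24.SlotTransportParity (slotPsiS_neg)
open Summit.QuantumFields.BalabanUV.Beta.GAN24.CombTransportedBorder (slotPsiS_entry_eq_zero)
open Summit.QuantumFields.BalabanUV.Beta.GAN24.CombSlotResumTransport (tsum_prod_weight_conj_psiKS tsum_sum_conj_psiKS_inr_inl_mul_periodic)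
open Summit.QuantumFields.BalabanUV.Beta.GAN24.LayerCommutatorAntisymm (trK_unitK_coDress)
open Summit.QuantumFields.BalabanUV.Beta.BubbleParity (vertexOfK_apply_eq_zero trK_vertexOfK_of_antisymm)

namespace Summit.QuantumFields.BalabanUV.Beta.GAN24.TransportedWordTools

variable {d : ℕ}

/-! ## §1 The conjugated two-face word: re-association, and the outer legs drop -/

section Conj

variable {n : ℕ} (hn : 0 < n) {r : Fin (d + 1) → ℕ} (hr : r ∈ box (d + 1) n)
include hn hr

/-- [folklore] **THE SANDWICH `Ψ̂ X Ψ̂ᵀ` OF A DECAYING KERNEL DECAYS** (rate `δ∕4`; `Ψ̂` decays at every rate, `SymCorrectorKernel.decays_psiKS`). -/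
theorem exists_decays_sandwich {X : MKer (d + 1) (Fib d)} {C δ : ℝ} (hX : Decays X C δ) (hδ : 0 < δ) :
    ∃ C' : ℝ, 0 ≤ C' ∧ Decays (comp (comp (psiKS r n) X) (trK (psiKS r n))) C' (δ / 4) := by
  have h1 := decays_comp (decays_psiKS hn hr hδ.le) hX (show (0 : ℝ) ≤ δ / 2 by positivity) (by linarith)
  have h2 := decays_comp h1 (decays_trK (decays_psiKS hn hr (show (0 : ℝ) ≤ δ / 2 by positivity))) (show (0 : ℝ) ≤ δ / 4 by positivity) (by linarith)
  exact ⟨_, h2.nonneg (Sum.inl 0), h2⟩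

/-- [folklore] The sandwich of a spread kernel is spread. -/
theorem spr_sandwich {X : MKer (d + 1) (Fib d)} (hX : Spr X) : Spr (comp (comp (psiKS r n) X) (trK (psiKS r n))) := by
  obtain ⟨C, δ, hδ, hXd⟩ := hX
  obtain ⟨C', -, h⟩ := exists_decays_sandwich hn hr hXd hδ
  exact ⟨C', δ / 4, by positivity, h⟩

/-- [folklore] `Ψ̂ ∘ X` is spread for spread `X`. -/
theorem spr_psiKS_comp {X : MKer (d + 1) (Fib d)} (hX : Spr X) : Spr (comp (psiKS r n) X) := by
  obtain ⟨C, δ, hδ, hXd⟩ := hX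
  exact ⟨_, δ / 2, by positivity, decays_comp (decays_psiKS hn hr hδ.le) hXd (show (0 : ℝ) ≤ δ / 2 by positivity) (by linarith)⟩

/-- NOT IN PRINT; OUR BOOKKEEPING ([folklore]).  **RE-ASSOCIATION OF THE CONJUGATED WORD**: for localised `P′`, `V′` and a spread `X`,
`((Ψ̂ᵀ ∘ P′ ∘ Ψ̂) ∘ X) ∘ (Ψ̂ᵀ ∘ V′ ∘ Ψ̂) = Ψ̂ᵀ ∘ ((P′ ∘ (Ψ̂ ∘ X ∘ Ψ̂ᵀ)) ∘ V′) ∘ Ψ̂` (an5's `comp_assoc_tame`, six times). -/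
theorem conj_word_assoc {P V X : MKer (d + 1) (Fib d)} (hP : Loc P) (hV : Loc V) (hX : Spr X) :
    comp (comp (comp (comp (trK (psiKS r n)) P) (psiKS r n)) X) (comp (comp (trK (psiKS r n)) V) (psiKS r n))
      = comp (comp (trK (psiKS r n)) (comp (comp P (comp (comp (psiKS r n) X) (trK (psiKS r n)))) V)) (psiKS r n) := by
  have hΨ : Spr (psiKS r n) := spr_psiKS hn hr
  have hΨt : Spr (trK (psiKS r n)) := hΨ.trK
  have hTP : Loc (comp (trK (psiKS r n)) P) := hΨt.comp_loc hP
  have hΨX : Spr (comp (psiKS r n) X) := spr_psiKS_comp hn hr hX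
  have hY : Spr (comp (comp (psiKS r n) X) (trK (psiKS r n))) := spr_sandwich hn hr hX
  have hA : Loc (comp (comp (trK (psiKS r n)) P) (comp (psiKS r n) X)) := hTP.comp_spr hΨX
  have hPY : Loc (comp P (comp (comp (psiKS r n) X) (trK (psiKS r n)))) := hP.comp_spr hY
  calc comp (comp (comp (comp (trK (psiKS r n)) P) (psiKS r n)) X) (comp (comp (trK (psiKS r n)) V) (psiKS r n))
      = comp (comp (comp (trK (psiKS r n)) P) (comp (psiKS r n) X)) (comp (comp (trK (psiKS r n)) V) (psiKS r n)) := by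
        rw [← comp_assoc_tame hTP.tame hΨ.tame hX.tame]
    _ = comp (comp (comp (trK (psiKS r n)) P) (comp (psiKS r n) X)) (comp (trK (psiKS r n)) (comp V (psiKS r n))) := by
        rw [← comp_assoc_tame hΨt.tame hV.tame hΨ.tame]
    _ = comp (comp (comp (comp (trK (psiKS r n)) P) (comp (psiKS r n) X)) (trK (psiKS r n))) (comp V (psiKS r n)) := by
        rw [comp_assoc_tame hA.tame hΨt.tame (hV.comp_spr hΨ).tame]
    _ = comp (comp (comp (trK (psiKS r n)) P) (comp (comp (psiKS r n) X) (trK (psiKS r n)))) (comp V (psiKS r n)) := by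
        rw [← comp_assoc_tame hTP.tame hΨX.tame hΨt.tame]
    _ = comp (comp (trK (psiKS r n)) (comp P (comp (comp (psiKS r n) X) (trK (psiKS r n))))) (comp V (psiKS r n)) := by
        rw [← comp_assoc_tame hΨt.tame hP.tame hY.tame]
    _ = comp (comp (comp (trK (psiKS r n)) (comp P (comp (comp (psiKS r n) X) (trK (psiKS r n))))) V) (psiKS r n) := by
        rw [comp_assoc_tame (hΨt.comp_loc hPY).tame hV.tame hΨ.tame]
    _ = comp (comp (trK (psiKS r n)) (comp (comp P (comp (comp (psiKS r n) X) (trK (psiKS r n)))) V)) (psiKS r n) := by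
        rw [← comp_assoc_tame hΨt.tame hPY.tame hV.tame]

/-- [folklore] **ONE RATE FOR THE INNER WORD**: `(P′ ∘ Ψ̂XΨ̂ᵀ) ∘ V′` is bi-localised at (first point of `P′`, second point of `V′`). -/
theorem exists_biLoc_inner_word {P V X : MKer (d + 1) (Fib d)} {p p' q q' : Site (d + 1)} {CP δP CV δV CX δX : ℝ}
    (hP : BiLoc P p p' CP δP) (hδP : 0 < δP) (hV : BiLoc V q q' CV δV) (hδV : 0 < δV) (hX : Decays X CX δX) (hδX : 0 < δX) :
    ∃ CZ δZ : ℝ, 0 < δZ ∧ BiLoc (comp (comp P (comp (comp (psiKS r n) X) (trK (psiKS r n)))) V) p q' CZ δZ := by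
  obtain ⟨CY, -, hY⟩ := exists_decays_sandwich hn hr hX hδX
  set m : ℝ := min δP (min δV (δX / 4)) with hm
  have hm0 : 0 < m := lt_min hδP (lt_min hδV (by positivity))
  have hP1 : BiLoc P p p' |CP| m := biLoc_of_le hP (min_le_left _ _)
  have hY1 : Decays (comp (comp (psiKS r n) X) (trK (psiKS r n))) |CY| m := decays_of_le hY ((min_le_right _ _).trans (min_le_right _ _))
  have hPY := biLoc_comp_right hP1 hY1 (show (0 : ℝ) ≤ m / 2 by positivity) (by linarith)
  have hV1 : BiLoc V q q' |CV| (m / 2) := biLoc_of_le hV (by linarith [min_le_right δP (min δV (δX / 4)), min_le_left δV (δX / 4)])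
  exact ⟨_, m / 2, half_pos hm0, biLoc_comp_biLoc hPY hV1 (half_pos hm0)⟩

/-- NOT IN PRINT; OUR BOOKKEEPING ([folklore]).  **UNDER PERIODIC BOUNDED LEG WEIGHTS THE OUTER LEGS OF THE CONJUGATED WORD DROP**: for localised `P′` (at `(p,p′)`), `V′` (at `(q,q′)`),
a decaying `X` and `n`-periodic bounded weights `ω₁ ω₂`,
`Σ'_{(y,w)} ω₁ y·ω₂ w·(((Ψ̂ᵀP′Ψ̂) ∘ X) ∘ (Ψ̂ᵀV′Ψ̂)) y w a b = Σ'_{(y,w)} ω₁ y·ω₂ w·((P′ ∘ (Ψ̂XΨ̂ᵀ)) ∘ V′) y w a b` (`conj_word_assoc` ⨾ leaf-01 g85 F8 §3c `tsum_prod_weight_conj_psiKS`). -/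
theorem tsum_twoFace_conj_word_eq {P V X : MKer (d + 1) (Fib d)} {p p' q q' : Site (d + 1)} {CP δP CV δV CX δX : ℝ}
    (hP : BiLoc P p p' CP δP) (hδP : 0 < δP) (hV : BiLoc V q q' CV δV) (hδV : 0 < δV) (hX : Decays X CX δX) (hδX : 0 < δX)
    {ω₁ ω₂ : Site (d + 1) → ℝ} {B₁ B₂ : ℝ} (h₁ : ∀ y, |ω₁ y| ≤ B₁) (h₁per : ∀ y t : Site (d + 1), ω₁ (y + (n : ℤ) • t) = ω₁ y)
    (h₂ : ∀ w, |ω₂ w| ≤ B₂) (h₂per : ∀ w t : Site (d + 1), ω₂ (w + (n : ℤ) • t) = ω₂ w) (a b : Fib d) :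
    ∑' yw : Site (d + 1) × Site (d + 1), ω₁ yw.1 * ω₂ yw.2 *
        comp (comp (comp (comp (trK (psiKS r n)) P) (psiKS r n)) X) (comp (comp (trK (psiKS r n)) V) (psiKS r n)) yw.1 yw.2 a b
      = ∑' yw : Site (d + 1) × Site (d + 1), ω₁ yw.1 * ω₂ yw.2 * comp (comp P (comp (comp (psiKS r n) X) (trK (psiKS r n)))) V yw.1 yw.2 a b := by
  rw [conj_word_assoc hn hr ⟨p, p', _, _, hδP, hP⟩ ⟨q, q', _, _, hδV, hV⟩ ⟨_, _, hδX, hX⟩]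
  obtain ⟨CZ, δZ, hδZ, hZ⟩ := exists_biLoc_inner_word hn hr hP hδP hV hδV hX hδX
  exact tsum_prod_weight_conj_psiKS hn hr hZ hδZ h₁ h₁per h₂ h₂per a b

end Conj

/-! ## §2 Structural transfers through the slot transport and the units -/

section Slot

variable (r : Fin (d + 1) → ℕ) (n : ℕ)

/-- [folklore] **LEG ANTISYMMETRY PASSES THE SLOT TRANSPORT** (`slotPsiS` is a linear combination of the members at the same legs: `slotPsiS_apply_kernel`, `slotPsiS_neg`). -/
theorem slotPsiS_antisymm {T : Fin (d + 1) → Site (d + 1) → MKer (d + 1) (Fib d)} (hT : ∀ (κ : Fin (d + 1)) (u x z : Site (d + 1)) (a b : Fib d), T κ u z x b a = -T κ u x z a b)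
    (κ : Fin (d + 1)) (u x z : Site (d + 1)) (a b : Fib d) : slotPsiS r n T κ u z x b a = -slotPsiS r n T κ u x z a b := by
  rw [slotPsiS_apply_kernel, slotPsiS_apply_kernel]
  have e : (fun κ' u' => T κ' u' z x b a) = -(fun κ' u' => T κ' u' x z a b) := by
    funext κ' u'
    exact hT κ' u' x z a b
  rw [e, slotPsiS_neg]
  rfl

/-- [folklore] Leg antisymmetry passes the unit dressing (the units are leg-type scalars). -/
theorem unitS_antisymm (sf sm : ℝ) {S : Fin (d + 1) → Site (d + 1) → MKer (d + 1) (Fib d)}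
    (hS : ∀ (κ : Fin (d + 1)) (u x z : Site (d + 1)) (a b : Fib d), S κ u z x b a = -S κ u x z a b)
    (κ : Fin (d + 1)) (u x z : Site (d + 1)) (a b : Fib d) : unitS sf sm S κ u z x b a = -unitS sf sm S κ u x z a b := by
  simp only [unitS_apply, hS κ u x z a b]
  ring

/-- NOT IN PRINT; OUR BOOKKEEPING ([folklore]).  **THE VERTEX OVER `unitS (slotPsiS T)` IS LEG-ANTISYMMETRIC WHEN `T` IS** (leaf-02's `BubbleParity.trK_vertexOfK_of_antisymm`). -/
theorem trK_vertexOfK_unitS_slotPsiS (K : MKer (d + 1) (Fib d)) (N : ℕ) (sf sm : ℝ) {T : Fin (d + 1) → Site (d + 1) → MKer (d + 1) (Fib d)}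
    (hT : ∀ (κ : Fin (d + 1)) (u x z : Site (d + 1)) (a b : Fib d), T κ u z x b a = -T κ u x z a b) (ν : Fin (d + 1)) (u' : Site (d + 1)) :
    trK (vertexOfK K N (unitS sf sm (slotPsiS r n T)) ν u') = -vertexOfK K N (unitS sf sm (slotPsiS r n T)) ν u' :=
  trK_vertexOfK_of_antisymm (fun κ' u x z a b => unitS_antisymm sf sm (slotPsiS_antisymm r n hT) κ' u x z a b) ν u'

variable {n} in
/-- NOT IN PRINT; OUR BOOKKEEPING ([folklore]).  **AN ENTRYWISE VANISHING OF EVERY MEMBER PASSES TO THE VERTEX OVER `unitS (slotPsiS T)`** (`CombTransportedBorder.slotPsiS_entry_eq_zero`,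
`BubbleParity.vertexOfK_apply_eq_zero`): used for «no ff block» and «no multiplier first-leg rows». -/
theorem vertexOfK_unitS_slotPsiS_entry_eq_zero (K : MKer (d + 1) (Fib d)) (N : ℕ) (sf sm : ℝ) {T : Fin (d + 1) → Site (d + 1) → MKer (d + 1) (Fib d)} {a b : Fib d}
    (hT : ∀ (κ : Fin (d + 1)) (t x z : Site (d + 1)), T κ t x z a b = 0) (ν : Fin (d + 1)) (u' x z : Site (d + 1)) :
    vertexOfK K N (unitS sf sm (slotPsiS r n T)) ν u' x z a b = 0 :=
  vertexOfK_apply_eq_zero (fun κ' t x' z' => by rw [unitS_apply, slotPsiS_entry_eq_zero r (fun κ u => hT κ u x' z') κ' t, mul_zero, zero_mul, mul_zero]) ν u' x z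

end Slot

/-! ## §3 `sgnK` and `trK` of the sandwich -/

section Sandwich

variable (r : Fin (d + 1) → ℕ) (n : ℕ)

/-- [folklore] `Ψ̂` is leg-type diagonal: `Ψ̂ x y a f · sgnF f = sgnF a · Ψ̂ x y a f`. -/
theorem psiKS_sgnF (x y : Site (d + 1)) (a f : Fib d) : psiKS r n x y a f * sgnF f = sgnF a * psiKS r n x y a f := by
  rcases a with α | μ <;> rcases f with β | μ'
  · rw [sgnF_inl, sgnF_inl, mul_one, one_mul]
  · rw [psiKS_inl_inr, zero_mul, mul_zero]
  · rw [psiKS_inr_inl, zero_mul, mul_zero]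
  · rw [sgnF_inr, sgnF_inr, mul_neg_one, neg_one_mul]

/-- [folklore] The same for `Ψ̂ᵀ`: `sgnF g · Ψ̂ᵀ w z g b = Ψ̂ᵀ w z g b · sgnF b`. -/
theorem sgnF_trK_psiKS (w z : Site (d + 1)) (g b : Fib d) : sgnF g * trK (psiKS r n) w z g b = trK (psiKS r n) w z g b * sgnF b := by
  rw [trK_apply, mul_comm, psiKS_sgnF, mul_comm]

/-- NOT IN PRINT; OUR BOOKKEEPING ([folklore]).  **`sgnK (Ψ̂ X Ψ̂ᵀ) = Ψ̂ (sgnK X) Ψ̂ᵀ`** — the leg signs pass the leg-type-diagonal `Ψ̂` on both sides (termwise, no summability needed). -/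
theorem sgnK_sandwich (X : MKer (d + 1) (Fib d)) :
    sgnK (comp (comp (psiKS r n) X) (trK (psiKS r n))) = comp (comp (psiKS r n) (sgnK X)) (trK (psiKS r n)) := by
  funext x z a b
  rw [sgnK_apply]
  show sgnF a * sgnF b * (∑' w, ∑ g, (∑' y, ∑ f, psiKS r n x y a f * X y w f g) * trK (psiKS r n) w z g b)
    = ∑' w, ∑ g, (∑' y, ∑ f, psiKS r n x y a f * sgnK X y w f g) * trK (psiKS r n) w z g b
  rw [← tsum_mul_left]
  refine tsum_congr fun w => ?_
  rw [Finset.mul_sum]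
  refine Finset.sum_congr rfl fun g _ => ?_
  have inner : (∑' y, ∑ f, psiKS r n x y a f * sgnK X y w f g) = sgnF a * sgnF g * ∑' y, ∑ f, psiKS r n x y a f * X y w f g := by
    rw [← tsum_mul_left]
    refine tsum_congr fun y => ?_
    rw [Finset.mul_sum]
    refine Finset.sum_congr rfl fun f _ => ?_
    rw [sgnK_apply]
    have h := psiKS_sgnF r n x y a f
    calc psiKS r n x y a f * (sgnF f * sgnF g * X y w f g) = (psiKS r n x y a f * sgnF f) * sgnF g * X y w f g := by ring
      _ = sgnF a * psiKS r n x y a f * sgnF g * X y w f g := by rw [h]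
      _ = sgnF a * sgnF g * (psiKS r n x y a f * X y w f g) := by ring
  rw [inner]
  have h2 := sgnF_trK_psiKS r n w z g b
  calc sgnF a * sgnF b * ((∑' y, ∑ f, psiKS r n x y a f * X y w f g) * trK (psiKS r n) w z g b)
      = sgnF a * (∑' y, ∑ f, psiKS r n x y a f * X y w f g) * (trK (psiKS r n) w z g b * sgnF b) := by ring
    _ = sgnF a * (∑' y, ∑ f, psiKS r n x y a f * X y w f g) * (sgnF g * trK (psiKS r n) w z g b) := by rw [h2]
    _ = sgnF a * sgnF g * (∑' y, ∑ f, psiKS r n x y a f * X y w f g) * trK (psiKS r n) w z g b := by ring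

variable {n} {r} in
/-- NOT IN PRINT; OUR BOOKKEEPING ([folklore]).  **`trK (Ψ̂ X Ψ̂ᵀ) = Ψ̂ (trK X) Ψ̂ᵀ`** for spread `X` (`trK_comp` twice, `trK_trK`, one tame re-association). -/
theorem trK_sandwich (hn : 0 < n) (hr : r ∈ box (d + 1) n) {X : MKer (d + 1) (Fib d)} (hX : Spr X) :
    trK (comp (comp (psiKS r n) X) (trK (psiKS r n))) = comp (comp (psiKS r n) (trK X)) (trK (psiKS r n)) := by
  have hΨ : Spr (psiKS r n) := spr_psiKS hn hr
  rw [trK_comp, trK_comp, trK_trK, comp_assoc_tame hΨ.tame hX.trK.tame hΨ.trK.tame]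

variable {n} {r} in
/-- NOT IN PRINT; OUR BOOKKEEPING ([folklore]).  **THE SANDWICH OF THE DRESSED STEP KERNEL IS `sgnK`-SYMMETRIC**: `trK (Ψ̂ X̃♮_j Ψ̂ᵀ) = sgnK (Ψ̂ X̃♮_j Ψ̂ᵀ)` (in-block kernel root, every `j`,
all units; leaf-02∕leaf-04 `LayerCommutatorAntisymm.trK_unitK_coDress` between `trK_sandwich` and `sgnK_sandwich`). -/
theorem trK_sandwich_dressedStep (hn : 0 < n) (hr : r ∈ box (d + 1) n) {Lc : ℕ} [NeZero Lc] {rb : Fin (d + 1) → ℕ} (hLc : 1 ≤ Lc) (hrb : rb ∈ box (d + 1) Lc)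
    (sf sm : ℝ) (j : ℕ) :
    trK (comp (comp (psiKS r n) (unitK sf sm (coDressKBmAt (toSite rb) Lc (KInvStep (d := d) Lc j)))) (trK (psiKS r n)))
      = sgnK (comp (comp (psiKS r n) (unitK sf sm (coDressKBmAt (toSite rb) Lc (KInvStep (d := d) Lc j)))) (trK (psiKS r n))) := by
  obtain ⟨δK, CK, hδK, -, hXd⟩ := decays_coDressKBmAt hLc hrb (decays_KInvStep (d := d) (Lc := Lc) j)
  rw [trK_sandwich hn hr ⟨_, _, hδK, decays_unitK (sf := sf) (sm := sm) hXd⟩, trK_unitK_coDress hrb j sf sm, sgnK_sandwich]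

end Sandwich

/-! ## §4 The `hkill`-transfer to the sandwiched middle kernel -/

section Kill

variable {n : ℕ} (hn : 0 < n) {r : Fin (d + 1) → ℕ} (hr : r ∈ box (d + 1) n)
include hn hr

/-- NOT IN PRINT; OUR BOOKKEEPING ([folklore]; leaf-01 g85 F8 §3b as an implication).  If the multiplier rows of a decaying `X` kill an `n`-periodic bounded current `t`, so do those of
`Ψ̂ X Ψ̂ᵀ`: `Σ'_z Σ_b (Ψ̂XΨ̂ᵀ)(y₁,z)_{inr m, inl b}·t b z = 0`. -/
theorem tsum_sum_sandwich_inr_inl_mul_eq_zero {X : MKer (d + 1) (Fib d)} {C δ : ℝ} (hX : Decays X C δ) (hδ : 0 < δ)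
    {t : Fin (d + 1) → Site (d + 1) → ℝ} {B : ℝ} (ht : ∀ b z, |t b z| ≤ B) (htper : ∀ (b : Fin (d + 1)) (z s : Site (d + 1)), t b (z + (n : ℤ) • s) = t b z)
    (hkill : ∀ (y₁ : Site (d + 1)) (m : Fin (d + 1)), ∑' z : Site (d + 1), ∑ b : Fin (d + 1), X y₁ z (Sum.inr m) (Sum.inl b) * t b z = 0)
    (y₁ : Site (d + 1)) (m : Fin (d + 1)) :
    ∑' z : Site (d + 1), ∑ b : Fin (d + 1), comp (comp (psiKS r n) X) (trK (psiKS r n)) y₁ z (Sum.inr m) (Sum.inl b) * t b z = 0 := by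
  rw [tsum_sum_conj_psiKS_inr_inl_mul_periodic hn hr hX hδ ht htper y₁ m]
  exact hkill y₁ m

end Kill

end Summit.QuantumFields.BalabanUV.Beta.GAN24.TransportedWordTools

end
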